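import Literature.NumberTheory.Rogawski1990.LocalEndoscopicChartDatumCM     -- ★ p840612 A-p16: §1 open regular loci, §3 the `G`-regular twin (+ its imports)
import HarnessLib

/-!
# The torus-coordinate chart datum on `H_v = U(Φ₂)(L⁺_v) × U(Φ₁)(L⁺_v)` at an `H`-REGULAR (possibly `G`-SINGULAR) point, non-split `v`
# (N6nsGerm (S2) «torus–singular», binder T1 of F0P2-p02's (α″) junction)

Topic `NumberTheory/Rogawski1990`; namespace `Literature.NumberTheory.Rogawski1990`. KERNEL mathematics only: one theorem, no definition, no named fact, no instance,
no notation, no `sorry`.  Cell `pub/hodgecm-mathlib` (LEAD F0P3a-plan (g9) T8-38 (1) ∕ T8-78; road «N6nsGerm» stub `stub_N6nsS2`, F0P2-p02 (g8)'s census (α″) 6e3491ee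
binder T1).  ★ p840612 `exists_chartDatum_H_local_centralizer` asks the base point `γH ∈ H_v` to be `G`-REGULAR; at the (S2) point `εH = (A_{a,b}, a)` it is only
`H`-regular.  Its proof used `G`-regularity solely (i) to know `A` regular semisimple (the Cayley chart on the `U(Φ₂)`-factor) and (ii) as the OPEN predicate shrunk into
the box; both survive with «`IsRegularElt (·).1.val`» (open by ★ `isOpen_setOf_isRegularElt_cmDatum_local`), which is this file.

* **`exists_chartDatum_H_local_centralizer_of_isRegularElt_fst`**.

HONEST SCOPE.  HC_CM is proved only modulo the printed citations until rung 0 closes; this file discharges no printed statement.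

## References
* [Rogawski1990] J. D. Rogawski, *Automorphic Representations of Unitary Groups in Three Variables*, Ann. of Math. Stud. 123 (1990), §3.1 p. 19, §4.3 p. 43, §8.2
  Prop. 8.2.1 (c) pp. 113–115.
* [HarishChandra1970] Harish-Chandra (notes by G. van Dijk), *Harmonic Analysis on Reductive p-adic Groups*, LNM 162 (1970), Part I §3.
-/

set_option autoImplicit false

noncomputable section

open Set Filter Topology Polynomial NumberField IsDedekindDomain
open Literature.NumberTheory.Automorphic Literature.NumberTheory.Automorphic.UnitaryGroup
open scoped Matrix MatrixGroups Pointwise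

namespace Literature.NumberTheory.Rogawski1990

variable (L : Type) [Field L] [NumberField L] [IsCMField L] {v : HeightOneSpectrum (𝓞 ↥(maximalRealSubfield L))}

section Hside

/-- Compact-open neighbourhoods inside any neighbourhood, in a locally compact Hausdorff totally disconnected space. [folklore] -/
private theorem exists_isCompact_isOpen_mem_subset_of_mem_nhds' {X : Type*} [TopologicalSpace X] [LocallyCompactSpace X] [T2Space X]
    [TotallyDisconnectedSpace X] {x : X} {U : Set X} (hU : U ∈ 𝓝 x) :
    ∃ V : Set X, IsCompact V ∧ IsOpen V ∧ x ∈ V ∧ V ⊆ U := by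
  obtain ⟨K, hKc, hxK⟩ := WeaklyLocallyCompactSpace.exists_compact_mem_nhds x
  have hx' : x ∈ interior (K ∩ U) := mem_interior_iff_mem_nhds.2 (inter_mem hxK hU)
  obtain ⟨C, hCclopen, hxC, hCsub⟩ :=
    (loc_compact_Haus_tot_disc_of_zero_dim (H := X)).exists_subset_of_mem_open hx' isOpen_interior
  exact ⟨C, hKc.of_isClosed_subset hCclopen.1 (hCsub.trans (interior_subset.trans inter_subset_left)), hCclopen.2, hxC,
    hCsub.trans (interior_subset.trans inter_subset_right)⟩

set_option maxHeartbeats 1000000 in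
/-- **N6ns (S2) CM DRESS on `H_v` at an `H`-REGULAR base point, TORUS COORDINATES** (F0P2-p02's (α″) junction binder T1).  `v` non-split, `γH = (A, u) ∈ H_v` with `A`
REGULAR SEMISIMPLE in `U(Φ₂)` (`IsRegularElt γH.1.val`) — `γH` may be `G`-SINGULAR (`u ∈ spec A`, print's Prop. 8.2.1 (c) point `(A_{a,b}, a)`).  Same conclusion as ★
`exists_chartDatum_H_local_centralizer` except that the box clause (reg) reads «`IsRegularElt (↑t).1.val ∧ Z(↑t) = Z(γH)`» (the OPEN `U(Φ₂)`-regular locus replaces the `G`-regular one);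
(SAT) and (SEP-st) unchanged.  Proof = ★ §3's verbatim with the open predicate swapped. [cite: Rogawski1990, §3.1 p. 19; §4.3 p. 43; §8.2 Prop. 8.2.1 (c) p. 113] [cite: HarishChandra1970, Part I §3] -/
theorem exists_chartDatum_H_local_centralizer_of_isRegularElt_fst (w : PlacesOver L v) (hw : IsCMField.complexConj L • w.1 = w.1)
    (γH : (cmDatum L 2 (Matrix.of fun i j : Fin 2 => if i.val + j.val + 1 = 2 then (1 : L) else 0)).Local v ×
      (cmDatum L 1 (Matrix.of fun i j : Fin 1 => if i.val + j.val + 1 = 1 then (1 : L) else 0)).Local v)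
    (hγH : IsRegularElt (γH.1.val : GL (Fin 2) (LocalRing L v))) :
    ∃ (A : Type) (_ : TopologicalSpace A)
      (s : A → (cmDatum L 2 (Matrix.of fun i j : Fin 2 => if i.val + j.val + 1 = 2 then (1 : L) else 0)).Local v ×
        (cmDatum L 1 (Matrix.of fun i j : Fin 1 => if i.val + j.val + 1 = 1 then (1 : L) else 0)).Local v)
      (e : OpenPartialHomeomorph
        (A × ↥(Subgroup.centralizer ({γH} : Set ((cmDatum L 2 (Matrix.of fun i j : Fin 2 => if i.val + j.val + 1 = 2 then (1 : L) else 0)).Local v ×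
          (cmDatum L 1 (Matrix.of fun i j : Fin 1 => if i.val + j.val + 1 = 1 then (1 : L) else 0)).Local v))))
        ((cmDatum L 2 (Matrix.of fun i j : Fin 2 => if i.val + j.val + 1 = 2 then (1 : L) else 0)).Local v ×
          (cmDatum L 1 (Matrix.of fun i j : Fin 1 => if i.val + j.val + 1 = 1 then (1 : L) else 0)).Local v))
      (a₀ : A)
      (t₀ : ↥(Subgroup.centralizer ({γH} : Set ((cmDatum L 2 (Matrix.of fun i j : Fin 2 => if i.val + j.val + 1 = 2 then (1 : L) else 0)).Local v ×
          (cmDatum L 1 (Matrix.of fun i j : Fin 1 => if i.val + j.val + 1 = 1 then (1 : L) else 0)).Local v)))),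
      Continuous s ∧
      (t₀ : (cmDatum L 2 (Matrix.of fun i j : Fin 2 => if i.val + j.val + 1 = 2 then (1 : L) else 0)).Local v ×
        (cmDatum L 1 (Matrix.of fun i j : Fin 1 => if i.val + j.val + 1 = 1 then (1 : L) else 0)).Local v) = γH ∧
      (a₀, t₀) ∈ e.source ∧
      (∀ p ∈ e.source, e p = s p.1 * (p.2 : _) * (s p.1)⁻¹) ∧
      ∀ O ∈ 𝓝 (a₀, t₀), ∃ (K : Set A)
        (B₁ : Set ↥(Subgroup.centralizer ({γH} : Set ((cmDatum L 2 (Matrix.of fun i j : Fin 2 => if i.val + j.val + 1 = 2 then (1 : L) else 0)).Local v ×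
          (cmDatum L 1 (Matrix.of fun i j : Fin 1 => if i.val + j.val + 1 = 1 then (1 : L) else 0)).Local v)))),
        IsCompact K ∧ IsOpen K ∧ a₀ ∈ K ∧ IsCompact B₁ ∧ IsOpen B₁ ∧ t₀ ∈ B₁ ∧ K ×ˢ B₁ ⊆ O ∧ K ×ˢ B₁ ⊆ e.source ∧
        (∀ t ∈ B₁, IsRegularElt ((t : (cmDatum L 2 (Matrix.of fun i j : Fin 2 => if i.val + j.val + 1 = 2 then (1 : L) else 0)).Local v ×
            (cmDatum L 1 (Matrix.of fun i j : Fin 1 => if i.val + j.val + 1 = 1 then (1 : L) else 0)).Local v).1.val : GL (Fin 2) (LocalRing L v)) ∧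
          Subgroup.centralizer ({(t : (cmDatum L 2 (Matrix.of fun i j : Fin 2 => if i.val + j.val + 1 = 2 then (1 : L) else 0)).Local v ×
            (cmDatum L 1 (Matrix.of fun i j : Fin 1 => if i.val + j.val + 1 = 1 then (1 : L) else 0)).Local v)} : Set _) =
            Subgroup.centralizer ({γH} : Set _)) ∧
        (∀ t ∈ B₁, ∀ x : (cmDatum L 2 (Matrix.of fun i j : Fin 2 => if i.val + j.val + 1 = 2 then (1 : L) else 0)).Local v ×
            (cmDatum L 1 (Matrix.of fun i j : Fin 1 => if i.val + j.val + 1 = 1 then (1 : L) else 0)).Local v,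
          x * (t : _) * x⁻¹ ∈ e '' (K ×ˢ B₁) →
            x ∈ s '' K * (Subgroup.centralizer ({γH} : Set ((cmDatum L 2 (Matrix.of fun i j : Fin 2 => if i.val + j.val + 1 = 2 then (1 : L) else 0)).Local v ×
              (cmDatum L 1 (Matrix.of fun i j : Fin 1 => if i.val + j.val + 1 = 1 then (1 : L) else 0)).Local v)) : Set _)) ∧
        (∀ t ∈ B₁, ∀ t' ∈ B₁, IsLocalStablyConjH L v (t : _) (t' : _) → t = t') := by
  classical
  obtain ⟨γ₂, u₀⟩ := γH
  -- `L_w` as a complete proper totally disconnected non-trivially normed field of characteristic zero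
  letI : NontriviallyNormedField (w.1.adicCompletion L) := Valued.toNontriviallyNormedField (w.1.adicCompletion L) (WithZero (Multiplicative ℤ))
  haveI : ProperSpace (w.1.adicCompletion L) := properSpace_adicCompletion L w.1
  haveI : CharZero (w.1.adicCompletion L) := charZero_of_injective_algebraMap (algebraMap L _).injective
  haveI : TotallyDisconnectedSpace (w.1.adicCompletion L) := Valued.totallyDisconnectedSpace'
  -- the one-place model of the `U(Φ₂)`-factor and the regular image point
  set φ := localNonsplitEquiv (IsCMField.complexConj L) (Matrix.of fun i j : Fin 2 => if i.val + j.val + 1 = 2 then (1 : L) else 0)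
    (IsCMField.complexConj_ne_one L) w hw with hφ
  have hreg₂ : IsRegularElt (γ₂.val : GL (Fin 2) (LocalRing L v)) := hγH
  have hsep : ((((φ γ₂ : unitaryGroupOfForm (galAdicCompletionMap (L := L) (IsCMField.complexConj L) hw)
      (placeForm (Matrix.of fun i j : Fin 2 => if i.val + j.val + 1 = 2 then (1 : L) else 0) w.1)) :
      GL (Fin 2) (w.1.adicCompletion L)) : Matrix (Fin 2) (Fin 2) (w.1.adicCompletion L)).charpoly).Separable := by
    rw [hφ]
    exact (isRegularElt_iff_charpoly_localNonsplitEquiv L _ w hw γ₂).1 hreg₂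
  have hJ : IsUnit (placeForm (Matrix.of fun i j : Fin 2 => if i.val + j.val + 1 = 2 then (1 : L) else 0) w.1).det :=
    (Matrix.isUnit_iff_isUnit_det _).1 (isUnit_placeForm_of_isUnit_det (isUnit_antidiagOne_det (L := L) (N := 2)) w.1)
  -- FILE 1 at `φ γ₂`, FILE 1b torus form, transport along `φ⁻¹`
  obtain ⟨s₁, τ₁, e₁, a₀, b₀, -, -, hs₁, hτ₁, -, -, hs₁0, hτ₁0, hcomm₁, -, he₁, hbox₁⟩ :=
    exists_unitary_cayleyChartDatum (galAdicCompletionMap (L := L) (IsCMField.complexConj L) hw)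
      (continuous_galAdicCompletionMap L (IsCMField.complexConj L) hw) hJ (φ γ₂) hsep
  haveI : Nonempty _ := ⟨b₀⟩
  obtain ⟨eT, t₁, ht₁, hT₀, heT, hboxT⟩ :=
    exists_torus_chartDatum_of_chartDatum hsep s₁ τ₁ hτ₁ e₁ (fun p _ => he₁ p) hs₁0 hτ₁0 hcomm₁ hbox₁
  obtain ⟨e₂, he₂src, -, he₂, hbox₂⟩ :=
    exists_chartDatum_transport φ.symm s₁ (fun t : ↥(Subgroup.centralizer ({φ γ₂} : Set _)) => (t : _)) eT heT
      (Subgroup.centralizer ({φ γ₂} : Set _))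
      (fun u => (((u : GL (Fin 2) (w.1.adicCompletion L)) : Matrix (Fin 2) (Fin 2) (w.1.adicCompletion L)).charpoly).Separable)
      (fun _ => True) (fun _ _ => trivial)
      (fun x y => IsConj (x : GL (Fin 2) (w.1.adicCompletion L)) (y : GL (Fin 2) (w.1.adicCompletion L)))
      (fun x y : (cmDatum L 2 (Matrix.of fun i j : Fin 2 => if i.val + j.val + 1 = 2 then (1 : L) else 0)).Local v =>
        IsStablyConj (conjLocal L (IsCMField.complexConj L) v)
          ((adelicForm L 2 (Matrix.of fun i j : Fin 2 => if i.val + j.val + 1 = 2 then (1 : L) else 0)).map (adeleToLocal L v)) x y)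
      (fun t t' h => by
        have h1 := isConj_localNonsplitEquiv_of_isStablyConj L _ w hw h
        rwa [← hφ, φ.apply_symm_apply, φ.apply_symm_apply] at h1)
      hboxT
  have hφγ : φ.symm (φ γ₂) = γ₂ := φ.symm_apply_apply γ₂
  have hTeq : (Subgroup.centralizer ({φ γ₂} : Set _)).map φ.symm.toMulEquiv.toMonoidHom =
      Subgroup.centralizer ({γ₂} : Set ((cmDatum L 2 (Matrix.of fun i j : Fin 2 => if i.val + j.val + 1 = 2 then (1 : L) else 0)).Local v)) := by
    rw [← centralizer_singleton_map_equiv φ.symm.toMulEquiv (φ γ₂)]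
    show Subgroup.centralizer ({φ.symm (φ γ₂)} : Set _) = _
    rw [hφγ]
    rfl
  -- the abelian factor `U(Φ₁)(L⁺_v)`
  have hcomm1 : ∀ x y : (cmDatum L 1 (Matrix.of fun i j : Fin 1 => if i.val + j.val + 1 = 1 then (1 : L) else 0)).Local v, x * y = y * x :=
    fun x y => Subtype.ext (gl_fin_one_comm _ _)
  haveI : TotallyDisconnectedSpace ((cmDatum L 1 (Matrix.of fun i j : Fin 1 => if i.val + j.val + 1 = 1 then (1 : L) else 0)).Local v) :=
    totallyDisconnectedSpace_cmDatum_local L 1 _ v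
  have hU : ∀ N ∈ 𝓝 u₀, ∃ C : Set ((cmDatum L 1 (Matrix.of fun i j : Fin 1 => if i.val + j.val + 1 = 1 then (1 : L) else 0)).Local v),
      IsCompact C ∧ IsOpen C ∧ u₀ ∈ C ∧ C ⊆ N := fun N hN => exists_isCompact_isOpen_mem_subset_of_mem_nhds' hN
  have hP₀ : IsRegularElt (((φ.symm ((t₁ : ↥(Subgroup.centralizer ({φ γ₂} : Set _))) : _), u₀) :
      (cmDatum L 2 (Matrix.of fun i j : Fin 2 => if i.val + j.val + 1 = 2 then (1 : L) else 0)).Local v ×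
        (cmDatum L 1 (Matrix.of fun i j : Fin 1 => if i.val + j.val + 1 = 1 then (1 : L) else 0)).Local v).1.val : GL (Fin 2) (LocalRing L v)) := by
    rw [ht₁, hφγ]
    exact hγH
  -- the product datum in coordinates `Z(φ γ₂) × U(Φ₁)(L⁺_v)`
  have h₀' : (a₀, t₁) ∈ e₂.source := (Set.ext_iff.mp he₂src (a₀, t₁)).mpr hT₀
  have hst : ∀ x y : (cmDatum L 2 (Matrix.of fun i j : Fin 2 => if i.val + j.val + 1 = 2 then (1 : L) else 0)).Local v ×
      (cmDatum L 1 (Matrix.of fun i j : Fin 1 => if i.val + j.val + 1 = 1 then (1 : L) else 0)).Local v,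
      IsLocalStablyConjH L v x y →
        IsStablyConj (conjLocal L (IsCMField.complexConj L) v)
          ((adelicForm L 2 (Matrix.of fun i j : Fin 2 => if i.val + j.val + 1 = 2 then (1 : L) else 0)).map (adeleToLocal L v)) x.1 y.1 ∧ x.2 = y.2 :=
    fun x y h => ⟨h.1, isStablyConj_iff_eq_of_fin_one.1 h.2⟩
  obtain ⟨s, τ, e, hsdef, hτdef, hsc, -, h₀, -, he, hbox⟩ :=
    exists_chartDatum_prod hcomm1 e₂ (fun a => φ.symm (s₁ a)) (φ.symm.continuous.comp hs₁)
      (fun t : ↥(Subgroup.centralizer ({φ γ₂} : Set _)) => φ.symm (t : _)) (φ.symm.continuous.comp continuous_subtype_val) he₂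
      h₀' ((Subgroup.centralizer ({φ γ₂} : Set _)).map φ.symm.toMulEquiv.toMonoidHom) (fun _ => True)
      (fun x y : (cmDatum L 2 (Matrix.of fun i j : Fin 2 => if i.val + j.val + 1 = 2 then (1 : L) else 0)).Local v =>
        IsStablyConj (conjLocal L (IsCMField.complexConj L) v)
          ((adelicForm L 2 (Matrix.of fun i j : Fin 2 => if i.val + j.val + 1 = 2 then (1 : L) else 0)).map (adeleToLocal L v)) x y)
      hbox₂ hU (fun x : (cmDatum L 2 (Matrix.of fun i j : Fin 2 => if i.val + j.val + 1 = 2 then (1 : L) else 0)).Local v ×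
        (cmDatum L 1 (Matrix.of fun i j : Fin 1 => if i.val + j.val + 1 = 1 then (1 : L) else 0)).Local v => IsRegularElt (x.1.val : GL (Fin 2) (LocalRing L v)))
      ((isOpen_setOf_isRegularElt_cmDatum_local L _ w hw).preimage continuous_fst) hP₀ (IsLocalStablyConjH L v) hst
  -- re-coordinatise onto `Z_{H_v}((γ₂, u₀))`
  obtain ⟨κ, hκ⟩ := exists_homeomorph_centralizer_prod hcomm1 φ.symm (φ γ₂) γ₂ hφγ u₀
  have hττ' : ∀ q, ((κ q : ↥(Subgroup.centralizer ({(γ₂, u₀)} : Set _))) : _) = τ q := fun q => by rw [hκ, hτdef]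
  obtain ⟨e₃, he₃src, -, he₃, hbox₃⟩ :=
    exists_chartDatum_recoord κ s τ
      (fun t : ↥(Subgroup.centralizer ({(γ₂, u₀)} : Set _)) =>
        (t : (cmDatum L 2 (Matrix.of fun i j : Fin 2 => if i.val + j.val + 1 = 2 then (1 : L) else 0)).Local v ×
          (cmDatum L 1 (Matrix.of fun i j : Fin 1 => if i.val + j.val + 1 = 1 then (1 : L) else 0)).Local v)) hττ' e he
      (((Subgroup.centralizer ({φ γ₂} : Set _)).map φ.symm.toMulEquiv.toMonoidHom).prod ⊤) (fun x : (cmDatum L 2 (Matrix.of fun i j : Fin 2 => if i.val + j.val + 1 = 2 then (1 : L) else 0)).Local v ×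
        (cmDatum L 1 (Matrix.of fun i j : Fin 1 => if i.val + j.val + 1 = 1 then (1 : L) else 0)).Local v => IsRegularElt (x.1.val : GL (Fin 2) (LocalRing L v)))
      (IsLocalStablyConjH L v) hbox
  have hTfin : ((Subgroup.centralizer ({φ γ₂} : Set _)).map φ.symm.toMulEquiv.toMonoidHom).prod ⊤ =
      Subgroup.centralizer ({(γ₂, u₀)} : Set ((cmDatum L 2 (Matrix.of fun i j : Fin 2 => if i.val + j.val + 1 = 2 then (1 : L) else 0)).Local v ×
        (cmDatum L 1 (Matrix.of fun i j : Fin 1 => if i.val + j.val + 1 = 1 then (1 : L) else 0)).Local v)) := by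
    rw [hTeq, centralizer_singleton_prod_of_comm hcomm1]
    rfl
  refine ⟨_, inferInstance, s, e₃, a₀, κ (t₁, u₀), hsc, ?_, ?_, he₃, ?_⟩
  · rw [hκ]
    show (φ.symm (t₁ : _), u₀) = (γ₂, u₀)
    rw [ht₁, hφγ]
    rfl
  · refine (he₃src _).2 ?_
    exact (congrArg (fun q => (a₀, q) ∈ e.source) (κ.symm_apply_apply (t₁, u₀))).mpr h₀
  · intro O hO
    obtain ⟨K, B₁, hKc, hKo, haK, hB₁c, hB₁o, htB, hKBO, hKBs, hreg, hsat, hsep⟩ := hbox₃ O hO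
    refine ⟨K, B₁, hKc, hKo, haK, hB₁c, hB₁o, htB, hKBO, hKBs, fun t ht => ⟨(hreg t ht).1, (hreg t ht).2.trans hTfin⟩,
      fun t ht x hx => ?_, hsep⟩
    obtain ⟨y, hy, z, hz, hyz⟩ := Set.mem_mul.1 (hsat t ht x hx)
    exact Set.mem_mul.2 ⟨y, hy, z, hTfin ▸ hz, hyz⟩

end Hside

end Literature.NumberTheory.Rogawski1990
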